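import Summits.KontsevichZagierPeriods.KontsevichZagierPeriods.Theorems.MultiplicationAccessible.Negative.Core
import Literature.NumberTheory.Transcendental.KZCubeRational
import Literature.NumberTheory.Transcendental.KZLogCalculusProofs
import Literature.NumberTheory.Transcendental.KZSubcalculusInvariants

/-!
# Crux `ReductionRigidity` (stmt-KontsevichZagierPeriods-3407), line `Sketch`
# (growth line `bloch-suslin-rational-dilog`): stub `stub_carrierDivisible`

The weight-`≤ 1` CARRIER subgroup `W = closure (W₁ ∪ W₂)` of the Kontsevich–Zagier formal group
(`KZ.FormalRep`, `KZ.relations`, `KZCalculus.lean`), generated by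

* `W₁`: the representations `[□², e/((α + βp₀)(γ + δp₁))]` on the closed square `□² = KZ.cube 2`
  with rational `e, α, β, γ, δ`, `0 < α`, `0 < α + β`, `0 < γ`, `0 < γ + δ` (products of two
  logarithmic slabs), and
* `W₂`: the representations `[□², e/(1 + p₀p₁)]`, `e ∈ ℚ` (the `ζ(2)`-line),

is DIVISIBLE MODULO MOVES: for every positive integer `M` and every `w ∈ W` there is `w' ∈ W` with
`w − M • w' ∈ KZ.relations`.  Proof: `AddSubgroup.closure_induction`.  On a generator
`[σ, f] = KZ.of r` take `w' = [σ, f/M] = KZ.of (r.constMul M⁻¹)` (`KZ.IntegralRep.constMul`: same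
domain, integrand `M⁻¹ • f`), which is again a generator of the same kind with `e` replaced by
`e/M`; and `[σ, f] − M • [σ, f/M] ∈ KZ.relations` is the landed generatorwise division
`MultiplicationAccessible.Negative.of_sub_nsmul_of_constMul_inv_mem_relations` (integrand
additivity `KZ.IntegralRep.of_constMul_nat_sub_nsmul_mem_relations` plus the congruence
`KZ.of_sub_of_mem_relations_of_eqOn`).  Zero, sums and negatives are formal.  The lead uses this
to remove the torsion multiple coming from Suslin's theorem (`B(ℚ)` is torsion) in
`DehnClosedReduces`.  No definitions and no named facts are introduced.

## References

* M. Kontsevich, D. Zagier, *Periods* (2001), §1.1–1.2, rule (1) (additivity).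
  [cite: KontsevichZagier2001, §1.2]
-/

noncomputable section

open MeasureTheory Set

namespace Summit.KontsevichZagierPeriods.HermiteRigidity.ReductionRigidity

open Literature.NumberTheory.Transcendental
open Literature.NumberTheory.Transcendental.KZ
open Summit.KontsevichZagierPeriods.MultiplicationAccessible.Negative
  (isAlgebraic_inv_nat of_sub_nsmul_of_constMul_inv_mem_relations)

/-- W7: the carrier sector is divisible modulo relations. For every `M > 0` and every `w` in the
carrier subgroup `W = closure (W₁ ∪ W₂)` (products of two logarithmic slabs, the `ζ(2)`-line) there
is `w' ∈ W` with `w − M • w' ∈ KZ.relations`: on a generator `[□², f] = KZ.of r` take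
`w' = [□², f/M] = KZ.of (r.constMul M⁻¹)`, a generator of the same kind with `e` replaced by `e/M`
(`of_sub_nsmul_of_constMul_inv_mem_relations`); then `AddSubgroup.closure_induction`.
[cite: KontsevichZagier2001, §1.2] -/
theorem stub_carrierDivisible : ∀ (M : ℕ), 0 < M → ∀ w ∈ AddSubgroup.closure
      ({c | ∃ (r : IntegralRep 2) (e α β γ δ : ℚ), 0 < α ∧ 0 < α + β ∧ 0 < γ ∧ 0 < γ + δ ∧
          r.domain = cube 2 ∧
          EqOn r.integrand (fun p => (e : ℝ) / (((α : ℝ) + β * p 0) * ((γ : ℝ) + δ * p 1))) (cube 2) ∧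
          c = KZ.of r} ∪
        {c | ∃ (r : IntegralRep 2) (e : ℚ), r.domain = cube 2 ∧
          EqOn r.integrand (fun p => (e : ℝ) / (1 + p 0 * p 1)) (cube 2) ∧ c = KZ.of r}),
    ∃ w' ∈ AddSubgroup.closure
      ({c | ∃ (r : IntegralRep 2) (e α β γ δ : ℚ), 0 < α ∧ 0 < α + β ∧ 0 < γ ∧ 0 < γ + δ ∧
          r.domain = cube 2 ∧
          EqOn r.integrand (fun p => (e : ℝ) / (((α : ℝ) + β * p 0) * ((γ : ℝ) + δ * p 1))) (cube 2) ∧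
          c = KZ.of r} ∪
        {c | ∃ (r : IntegralRep 2) (e : ℚ), r.domain = cube 2 ∧
          EqOn r.integrand (fun p => (e : ℝ) / (1 + p 0 * p 1)) (cube 2) ∧ c = KZ.of r}),
      w - M • w' ∈ KZ.relations := by
  intro M hM w hw
  induction hw using AddSubgroup.closure_induction with
  | mem c hc =>
    rcases hc with ⟨r, e, α, β, γ, δ, hα, hαβ, hγ, hγδ, hdom, hint, rfl⟩ | ⟨r, e, hdom, hint, rfl⟩
    · -- a product of two logarithmic slabs: divide the numerator `e` by `M`
      refine ⟨KZ.of (r.constMul ((M : ℝ)⁻¹) (isAlgebraic_inv_nat M)),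
        AddSubgroup.subset_closure (Or.inl ⟨_, e / M, α, β, γ, δ, hα, hαβ, hγ, hγδ,
          by rw [IntegralRep.domain_constMul, hdom], fun x hx => ?_, rfl⟩),
        of_sub_nsmul_of_constMul_inv_mem_relations r hM.ne'⟩
      simp only [IntegralRep.integrand_constMul]
      rw [hint hx]
      push_cast
      ring
    · -- the `ζ(2)`-line: divide the numerator `e` by `M`
      refine ⟨KZ.of (r.constMul ((M : ℝ)⁻¹) (isAlgebraic_inv_nat M)),
        AddSubgroup.subset_closure (Or.inr ⟨_, e / M,
          by rw [IntegralRep.domain_constMul, hdom], fun x hx => ?_, rfl⟩),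
        of_sub_nsmul_of_constMul_inv_mem_relations r hM.ne'⟩
      simp only [IntegralRep.integrand_constMul]
      rw [hint hx]
      push_cast
      ring
  | zero => exact ⟨0, zero_mem _, by rw [smul_zero, sub_zero]; exact zero_mem _⟩
  | add x y _ _ hx hy =>
    obtain ⟨x', hx', hx⟩ := hx
    obtain ⟨y', hy', hy⟩ := hy
    refine ⟨x' + y', add_mem hx' hy', ?_⟩
    have h : x + y - M • (x' + y') = (x - M • x') + (y - M • y') := by
      rw [smul_add]; abel
    rw [h]
    exact add_mem hx hy
  | neg x _ hx =>
    obtain ⟨x', hx', hx⟩ := hx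
    refine ⟨-x', neg_mem hx', ?_⟩
    have h : -x - M • (-x') = -(x - M • x') := by
      rw [smul_neg]; abel
    rw [h]
    exact neg_mem hx

end Summit.KontsevichZagierPeriods.HermiteRigidity.ReductionRigidity

end
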